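import Summits.CriticalPhenomena.PercolationContinuityZ3.Theorems.PercNearOneGluingNoHeavyLowerTailAPLTwoSidedReduction
import HarnessLib

/-!
# `NoHeavyLowerTail` (stmt-CriticalPhenomena-4575) — TWO-SIDED PARALLEL COMPOSITION III: the pendant-cell monotone moves and the
full extremal reduction of U(28/27) to `E = C` pieces

Support file (prover prim-ineq-gen-8 gen 60; `--supports stmt-CriticalPhenomena-4575`; memo
run/shared/lean/prim/prim-ineq-gen-8/FINDING-gen60-TWOSIDED.md).  No definitions, no named facts, no sorries.  Notation as in
`…APLTwoSidedReduction.lean`: cells `(x₀, B, A, m, τ)`, isolation coordinates `(Z, O, U, W) = (x₀, x₀+m, x₀+A, x₀+B)` (multiplicative under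
the 3-terminal union), `κ = (x₀+m)τ − AB`, `p = τ + B`, `π = τ + A`, `E = κ²/(pπm)`.
* `lowerU_le` — moving mass `δ ∈ [0, A]` from the cell `ov` to the all-joined cell (`U ↦ U − δ` at fixed `Z, O, W`) does not decrease `E`
  (indeed `κ ↦ κ + δ(x₀+m+B)`, `p ↦ p + δ`, and `κ ≤ p·(x₀+m+B)`); `lowerW_le` is the mirror statement for the cell `ou`.
* `comp_lowerU_le`, `comp_lowerW_le` — the composite of `x` with `U` lowered by `δ` and `y` is the composite of `x, y` with `U` lowered by
  `δ·U_y`; hence these moves on a factor can only increase the composite's `E`.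
Together with `fiber_le` / `comp_raise_le` (raising `Z`): every valid Harris piece with `E ≤ C` is joined to a piece with `E = C` EXACTLY by a
path of such moves (raise `Z` until a pendant cell or `m` vanishes, lower `U`/`W`; `E → ∞` as `m → 0`), along which the composite's `E` is
non-decreasing for every Harris partner.  CONSEQUENCE (memo gen 60 §0): the two-sided composition problem U(C) is EQUIVALENT to its
restriction to pairs with `E(x) = E(y) = C`, i.e. (for `C = 28/27`, with `p = a²`, `π = b²`, `m = g²/C`, `κ = abg`) to ONE explicit polynomial
inequality `P(a₁,b₁,g₁,a₂,b₂,g₂) ≥ 0` (1557 terms, degree 24) on an explicit compact basic semialgebraic set. [this work]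
-/

namespace Summit.CriticalPhenomena.PercolationContinuityZ3.Theorems

namespace APL

/-- **Lowering `U` does not decrease `E`.**  For cells `x₀, B, m, τ ≥ 0`, `0 ≤ δ ≤ A`... precisely `0 ≤ δ`, Harris `κ = (x₀+m)τ − AB ≥ 0`,
`C ≥ 0`: if the moved piece `(x₀, B, A−δ, m, τ+δ)` has `E ≤ C` then so has `(x₀, B, A, m, τ)` (division-free form). [this work] -/
theorem lowerU_le (C x0 B A m τ δ : ℝ) (hC : 0 ≤ C) (h0 : 0 ≤ x0) (hB : 0 ≤ B) (hA : 0 ≤ A) (hm : 0 ≤ m) (hτ : 0 ≤ τ)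
    (hδ : 0 ≤ δ) (hκ : 0 ≤ (x0 + m) * τ - A * B)
    (hE : ((x0 + m) * (τ + δ) - (A - δ) * B) ^ 2 ≤ C * ((τ + δ + B) * (τ + δ + (A - δ))) * m) :
    ((x0 + m) * τ - A * B) ^ 2 ≤ C * ((τ + B) * (τ + A)) * m := by
  set κ := (x0 + m) * τ - A * B with hκdef
  have eκ' : (x0 + m) * (τ + δ) - (A - δ) * B = κ + δ * (x0 + m + B) := by rw [hκdef]; ring
  have eπ : τ + δ + (A - δ) = τ + A := by ring
  rw [eκ', eπ] at hE
  have hq : 0 ≤ x0 + m + B := by positivity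
  have hp : 0 ≤ τ + B := by positivity
  have hπ : 0 ≤ τ + A := by positivity
  -- κ (p + δ) ≤ (κ + δ q_v) p  since κ ≤ p q_v :  p q_v − κ = B (x₀ + B + A + m + τ)
  have h1 : κ * (τ + δ + B) ≤ (κ + δ * (x0 + m + B)) * (τ + B) := by
    have e : (κ + δ * (x0 + m + B)) * (τ + B) - κ * (τ + δ + B) = δ * (B * (x0 + B + A + m + τ)) := by rw [hκdef]; ring
    have : 0 ≤ δ * (B * (x0 + B + A + m + τ)) := by positivity
    linarith
  have hκ'0 : 0 ≤ κ + δ * (x0 + m + B) := by positivity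
  rcases (mul_nonneg (mul_nonneg (add_nonneg (add_nonneg hτ hδ) hB) hπ) hm).eq_or_lt with hz | hpos
  · -- degenerate: (p+δ) π m = 0 ⟹ κ' = 0 ⟹ κ = 0
    have hE0 : (κ + δ * (x0 + m + B)) ^ 2 ≤ 0 := by
      have := hE; rw [show C * ((τ + δ + B) * (τ + A)) * m = C * ((τ + δ + B) * (τ + A) * m) by ring, ← hz] at this
      simpa using this
    have hκ'z : κ + δ * (x0 + m + B) = 0 := (pow_eq_zero_iff two_ne_zero).mp (le_antisymm hE0 (sq_nonneg _))
    have hκz : κ = 0 := le_antisymm (by nlinarith [mul_nonneg hδ hq]) hκ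
    rw [hκz]; have : 0 ≤ C * ((τ + B) * (τ + A)) * m := by positivity
    simpa using this
  · -- generic: κ²·(p+δ)πm ≤ κ κ' p π m ≤ κ'² pπm ≤ C (p+δ)π m · pπ m / ... ; divide by (p+δ) π m > 0
    have h2 : κ ^ 2 * ((τ + δ + B) * (τ + A) * m) ≤ (κ + δ * (x0 + m + B)) ^ 2 * ((τ + B) * (τ + A) * m) := by
      have hκκ' : κ ≤ κ + δ * (x0 + m + B) := by nlinarith [mul_nonneg hδ hq]
      have h3 : (κ * (τ + δ + B)) * κ ≤ ((κ + δ * (x0 + m + B)) * (τ + B)) * (κ + δ * (x0 + m + B)) :=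
        mul_le_mul h1 hκκ' hκ (le_trans (mul_nonneg hκ (by positivity)) h1)
      have h4 := mul_le_mul_of_nonneg_right h3 (mul_nonneg hπ hm)
      calc κ ^ 2 * ((τ + δ + B) * (τ + A) * m) = (κ * (τ + δ + B)) * κ * ((τ + A) * m) := by ring
        _ ≤ ((κ + δ * (x0 + m + B)) * (τ + B)) * (κ + δ * (x0 + m + B)) * ((τ + A) * m) := h4
        _ = (κ + δ * (x0 + m + B)) ^ 2 * ((τ + B) * (τ + A) * m) := by ring
    have h5 : (κ + δ * (x0 + m + B)) ^ 2 * ((τ + B) * (τ + A) * m) ≤ C * ((τ + δ + B) * (τ + A) * m) * ((τ + B) * (τ + A) * m) := by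
      have := mul_le_mul_of_nonneg_right hE (show 0 ≤ (τ + B) * (τ + A) * m by positivity)
      calc (κ + δ * (x0 + m + B)) ^ 2 * ((τ + B) * (τ + A) * m) ≤ C * ((τ + δ + B) * (τ + A)) * m * ((τ + B) * (τ + A) * m) := this
        _ = C * ((τ + δ + B) * (τ + A) * m) * ((τ + B) * (τ + A) * m) := by ring
    have h6 : κ ^ 2 * ((τ + δ + B) * (τ + A) * m) ≤ (C * ((τ + B) * (τ + A)) * m) * ((τ + δ + B) * (τ + A) * m) := by
      calc κ ^ 2 * ((τ + δ + B) * (τ + A) * m) ≤ C * ((τ + δ + B) * (τ + A) * m) * ((τ + B) * (τ + A) * m) := le_trans h2 h5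
        _ = (C * ((τ + B) * (τ + A)) * m) * ((τ + δ + B) * (τ + A) * m) := by ring
    exact le_of_mul_le_mul_right h6 hpos

/-- **Lowering `W` does not decrease `E`** (mirror of `lowerU_le`: mass `δ` from the cell `ou` to the all-joined cell). [this work] -/
theorem lowerW_le (C x0 B A m τ δ : ℝ) (hC : 0 ≤ C) (h0 : 0 ≤ x0) (hB : 0 ≤ B) (hA : 0 ≤ A) (hm : 0 ≤ m) (hτ : 0 ≤ τ)
    (hδ : 0 ≤ δ) (hκ : 0 ≤ (x0 + m) * τ - A * B)
    (hE : ((x0 + m) * (τ + δ) - A * (B - δ)) ^ 2 ≤ C * ((τ + δ + (B - δ)) * (τ + δ + A)) * m) :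
    ((x0 + m) * τ - A * B) ^ 2 ≤ C * ((τ + B) * (τ + A)) * m := by
  -- swap the roles of (u, B) and (v, A)
  have hκ' : 0 ≤ (x0 + m) * τ - B * A := by linarith [mul_comm A B]
  have hE' : ((x0 + m) * (τ + δ) - (B - δ) * A) ^ 2 ≤ C * ((τ + δ + A) * (τ + δ + (B - δ))) * m := by
    have e1 : ((x0 + m) * (τ + δ) - (B - δ) * A) ^ 2 = ((x0 + m) * (τ + δ) - A * (B - δ)) ^ 2 := by ring
    have e2 : C * ((τ + δ + A) * (τ + δ + (B - δ))) * m = C * ((τ + δ + (B - δ)) * (τ + δ + A)) * m := by ring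
    rw [e1, e2]; exact hE
  have h := lowerU_le C x0 A B m τ δ hC h0 hA hB hm hτ hδ hκ' hE'
  have e1 : ((x0 + m) * τ - A * B) ^ 2 = ((x0 + m) * τ - B * A) ^ 2 := by ring
  have e2 : C * ((τ + B) * (τ + A)) * m = C * ((τ + A) * (τ + B)) * m := by ring
  rw [e1, e2]; exact h

/-- **Lowering `U` on a factor lowers `U` on the composite** (by `δ·U_y = δ(y₀ + A′)`), so by `lowerU_le` + `comp_harris`: if the
composite of `(x₀, B, A−δ, m, τ+δ)` with `y` has `E ≤ C` then so has the composite of `x = (x₀,B,A,m,τ)` with `y` (both Harris, cells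
`≥ 0`, `0 ≤ δ ≤ A`).  Cells: `z` = composite of `x, y`; `w` = composite of the moved `x` with `y`. [this work] -/
theorem comp_lowerU_le (C x0 B A m τ y0 B' A' m' τ' δ zB zA zm zτ wB wA wm wτ : ℝ) (hC : 0 ≤ C)
    (h0 : 0 ≤ x0) (hB : 0 ≤ B) (hA : δ ≤ A) (hm : 0 ≤ m) (hτ : 0 ≤ τ) (hδ : 0 ≤ δ)
    (h0' : 0 ≤ y0) (hB' : 0 ≤ B') (hA' : 0 ≤ A') (hm' : 0 ≤ m') (hτ' : 0 ≤ τ')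
    (hκ : 0 ≤ (x0 + m) * τ - A * B) (hκ' : 0 ≤ (y0 + m') * τ' - A' * B')
    (hzB : zB = x0 * B' + B * y0 + B * B') (hzA : zA = x0 * A' + A * y0 + A * A')
    (hzm : zm = x0 * m' + m * y0 + m * m')
    (hzτ : zτ = τ * (y0 + B' + A' + m' + τ') + (x0 + B + A + m) * τ' + B * (A' + m') + A * (B' + m') + m * (B' + A'))
    (hwB : wB = x0 * B' + B * y0 + B * B') (hwA : wA = x0 * A' + (A - δ) * y0 + (A - δ) * A')
    (hwm : wm = x0 * m' + m * y0 + m * m')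
    (hwτ : wτ = (τ + δ) * (y0 + B' + A' + m' + τ') + (x0 + B + (A - δ) + m) * τ' + B * (A' + m') + (A - δ) * (B' + m')
        + m * (B' + A'))
    (hE : ((x0 * y0 + wm) * wτ - wA * wB) ^ 2 ≤ C * ((wτ + wB) * (wτ + wA)) * wm) :
    ((x0 * y0 + zm) * zτ - zA * zB) ^ 2 ≤ C * ((zτ + zB) * (zτ + zA)) * zm := by
  have hAx : 0 ≤ A := le_trans hδ hA
  -- the move on the composite: U lowered by δ·(y₀ + A′)
  have eA : wA = zA - δ * (y0 + A') := by rw [hwA, hzA]; ring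
  have eτ : wτ = zτ + δ * (y0 + A') := by rw [hwτ, hzτ]; ring
  have eB : wB = zB := by rw [hwB, hzB]
  have em : wm = zm := by rw [hwm, hzm]
  have hz0n : 0 ≤ x0 * y0 := by positivity
  have hzBn : 0 ≤ zB := by rw [hzB]; positivity
  have hzAn : 0 ≤ zA := by rw [hzA]; positivity
  have hzmn : 0 ≤ zm := by rw [hzm]; positivity
  have hzτn : 0 ≤ zτ := by rw [hzτ]; positivity
  have hδ' : 0 ≤ δ * (y0 + A') := by positivity
  have hκz : 0 ≤ (x0 * y0 + zm) * zτ - zA * zB := by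
    rw [hzm, hzτ, hzA, hzB]
    exact comp_harris x0 B A m τ y0 B' A' m' τ' h0 hB hAx hm hτ h0' hB' hA' hm' hτ' hκ hκ'
  rw [eA, eτ, eB, em] at hE
  have hE' : ((x0 * y0 + zm) * (zτ + δ * (y0 + A')) - (zA - δ * (y0 + A')) * zB) ^ 2
      ≤ C * ((zτ + δ * (y0 + A') + zB) * (zτ + δ * (y0 + A') + (zA - δ * (y0 + A')))) * zm := by
    have e2 : zτ + δ * (y0 + A') + (zA - δ * (y0 + A')) = zτ + zA := by ring
    rw [e2]
    have e3 : (zτ + δ * (y0 + A') + zB) * (zτ + zA) = (zτ + δ * (y0 + A') + zB) * (zτ + δ * (y0 + A') + (zA - δ * (y0 + A'))) := by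
      ring
    rw [← e3] at hE; exact hE
  exact lowerU_le C (x0 * y0) zB zA zm zτ (δ * (y0 + A')) hC hz0n hzBn hzAn hzmn hzτn hδ' hκz hE'

/-- **Lowering `W` on a factor lowers `W` on the composite** (by `δ·W_y = δ(y₀ + B′)`); mirror of `comp_lowerU_le`. [this work] -/
theorem comp_lowerW_le (C x0 B A m τ y0 B' A' m' τ' δ zB zA zm zτ wB wA wm wτ : ℝ) (hC : 0 ≤ C)
    (h0 : 0 ≤ x0) (hB : δ ≤ B) (hA : 0 ≤ A) (hm : 0 ≤ m) (hτ : 0 ≤ τ) (hδ : 0 ≤ δ)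
    (h0' : 0 ≤ y0) (hB' : 0 ≤ B') (hA' : 0 ≤ A') (hm' : 0 ≤ m') (hτ' : 0 ≤ τ')
    (hκ : 0 ≤ (x0 + m) * τ - A * B) (hκ' : 0 ≤ (y0 + m') * τ' - A' * B')
    (hzB : zB = x0 * B' + B * y0 + B * B') (hzA : zA = x0 * A' + A * y0 + A * A')
    (hzm : zm = x0 * m' + m * y0 + m * m')
    (hzτ : zτ = τ * (y0 + B' + A' + m' + τ') + (x0 + B + A + m) * τ' + B * (A' + m') + A * (B' + m') + m * (B' + A'))
    (hwB : wB = x0 * B' + (B - δ) * y0 + (B - δ) * B') (hwA : wA = x0 * A' + A * y0 + A * A')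
    (hwm : wm = x0 * m' + m * y0 + m * m')
    (hwτ : wτ = (τ + δ) * (y0 + B' + A' + m' + τ') + (x0 + (B - δ) + A + m) * τ' + (B - δ) * (A' + m') + A * (B' + m')
        + m * (B' + A'))
    (hE : ((x0 * y0 + wm) * wτ - wA * wB) ^ 2 ≤ C * ((wτ + wB) * (wτ + wA)) * wm) :
    ((x0 * y0 + zm) * zτ - zA * zB) ^ 2 ≤ C * ((zτ + zB) * (zτ + zA)) * zm := by
  have hBx : 0 ≤ B := le_trans hδ hB
  have eB : wB = zB - δ * (y0 + B') := by rw [hwB, hzB]; ring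
  have eτ : wτ = zτ + δ * (y0 + B') := by rw [hwτ, hzτ]; ring
  have eA : wA = zA := by rw [hwA, hzA]
  have em : wm = zm := by rw [hwm, hzm]
  have hz0n : 0 ≤ x0 * y0 := by positivity
  have hzBn : 0 ≤ zB := by rw [hzB]; positivity
  have hzAn : 0 ≤ zA := by rw [hzA]; positivity
  have hzmn : 0 ≤ zm := by rw [hzm]; positivity
  have hzτn : 0 ≤ zτ := by rw [hzτ]; positivity
  have hδ' : 0 ≤ δ * (y0 + B') := by positivity
  have hκz : 0 ≤ (x0 * y0 + zm) * zτ - zA * zB := by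
    rw [hzm, hzτ, hzA, hzB]
    exact comp_harris x0 B A m τ y0 B' A' m' τ' h0 hBx hA hm hτ h0' hB' hA' hm' hτ' hκ hκ'
  rw [eA, eτ, eB, em] at hE
  have hE' : ((x0 * y0 + zm) * (zτ + δ * (y0 + B')) - zA * (zB - δ * (y0 + B'))) ^ 2
      ≤ C * ((zτ + δ * (y0 + B') + (zB - δ * (y0 + B'))) * (zτ + δ * (y0 + B') + zA)) * zm := by
    have e2 : zτ + δ * (y0 + B') + (zB - δ * (y0 + B')) = zτ + zB := by ring
    rw [e2]
    have e3 : (zτ + zB) * (zτ + δ * (y0 + B') + zA) = (zτ + δ * (y0 + B') + (zB - δ * (y0 + B'))) * (zτ + δ * (y0 + B') + zA) := by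
      ring
    rw [← e3] at hE; exact hE
  exact lowerW_le C (x0 * y0) zB zA zm zτ (δ * (y0 + B')) hC hz0n hzBn hzAn hzmn hzτn hδ' hκz hE'

end APL

end Summit.CriticalPhenomena.PercolationContinuityZ3.Theorems
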